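import Literature.NumberTheory.LFunctions.Zhang2022.Section8ProfileSjRow
import Literature.NumberTheory.LFunctions.Zhang2022.KnifeEdgeLenZDegreeK0Poly
import HarnessLib

/-!
# Zhang (2022) §8 for profile data: the row (S) and the repaired K0 asymptotic for POLYNOMIAL SHORT PIECES (the pieces of
# the route's `PolyShortPairs` designs), via the `C²` row `sjProfileRow_C2` and an a.e.-congruence in the derivative datum

Topic `Literature/NumberTheory/LFunctions/Zhang2022` (Landau–Siegel audit tree; verdict-neutral). Y. Zhang, *Discrete mean
estimates and the Landau–Siegel zero*, arXiv:2211.02515v1 (2022) [Zhang2022LandauSiegel] — **an unrefereed manuscript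
under adjudication; nothing here asserts or denies its Theorems 1–2; no claim about Landau–Siegel zeros.** Cell
landau-siegel §D, crux K0 = stmt-Parity-20459 `InClassSideTablesPiece` (line «sjrows»), prover ls-knife-K0-p1 g2.

* `sjProfileMain_congr_ae`, `sjProfileRow_congr_ae` — the row (S) depends on the derivative datum `u′` only through its
  a.e.-class on `(0,1]` (so a kink at `θ`, where `InClassPiece`'s right derivative is `0` but the left limit is not, is
  harmless);
* `sjProfileRow_polyShortPiece` — **`PolyShortPiece θ u u′` with `0 < θ < 1` ⇒ `KnifeEdge.SjProfileRow c′ j u u′`** for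
  every `c′` and `j ∈ {1,2,3}` (`sjProfileRow_C2` applied to `u = p·1_{(-∞,θ)}` with the smooth derivative data
  `p′·1_{(-∞,θ]}`, `p″`, then the congruence);
* `sjProfileRow_of_vanish`, `sjProfileRow_polyShortPiece'` — degenerate lengths `θ ≤ 0`, hence every `θ < 1`;
* `inClassMean_polyShortPiece` — **the repaired K0 asymptotic for every polynomial short piece**: for all `c′ ≥ c₀`,
  `PolyShortPiece θ u u′`, `θ < 1`, `ε > 0`: eventually under (A),
  `|discMean c′ χ (profPoly χ · u (⌊P⌋+1)) − mainTermForm u u′·𝔞𝔓| ≤ ε𝔞𝔓` (g0's reduction `inClassMean_short_of_sjRows`,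
  p537807: Prop 7.1 + Lemma 8.1 + Prop 2.2(i) + Lemma 2.3, all tree theorems);
* `inClassMeanPoly_eventually` — the hypothesis `h0′` of the `_poly` glue (`KnifeEdgeLenZDegreeK0Poly`) DISCHARGED, hence
  **`theorem1_of_gradedClosesPsiOn_polyShort`**: the ψ-graded package ON any class of polynomial short pairs (lengths `< 1`),
  for all large `c′`, implies Theorem 1 — with NO side-table hypothesis left (an implication between the manuscript's nodes;
  the package itself is asserted by no one).

What this is NOT: the registered stub `stub_sjRows` / the slot `InClassMeanPiece c′` quantify over ALL `InClassPiece`s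
(kinked `H¹` profiles); this file settles the POLYNOMIAL short pieces (and `Section8ProfileSjRow` the `C²` ones).

## References
* Y. Zhang, arXiv:2211.02515v1 (2022), §7 Prop 7.1 (7.2); §8 Lemma 8.1, (8.10)–(8.12), (8.23).
  [cite: Zhang2022LandauSiegel, §8 pp.47–48, (8.23)]
-/

noncomputable section

open Complex Real MeasureTheory Set intervalIntegral Filter Polynomial
open scoped ComplexConjugate Topology

namespace Literature.NumberTheory.LFunctions.Zhang2022.DipoleRule

open Skeleton KnifeEdge

/-! ### The row depends on `u′` only almost everywhere on `(0,1]` -/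

/-- `𝔪_j(u)` is unchanged when `u′` is changed on a null set of `(0,1]`. [cite: Zhang2022LandauSiegel, Prop 7.1 pp.44–50] -/
theorem sjProfileMain_congr_ae {j : ℕ} {u u₁' u₂' : ℝ → ℂ}
    (h : ∀ᵐ z ∂volume, z ∈ Set.uIoc (0:ℝ) 1 → u₁' z = u₂' z) : sjProfileMain j u u₁' = sjProfileMain j u u₂' := by
  unfold sjProfileMain
  congr 1
  refine intervalIntegral.integral_congr_ae ?_
  filter_upwards [h] with z hz hmem
  simp only [k0jet, k0mass, hz hmem]

/-- **Row (S) is invariant under a.e. changes of `u′` on `(0,1]`.** [cite: Zhang2022LandauSiegel, §8 (8.9)–(8.12)] -/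
theorem sjProfileRow_congr_ae {c' : ℝ} {j : ℕ} {u u₁' u₂' : ℝ → ℂ}
    (h : ∀ᵐ z ∂volume, z ∈ Set.uIoc (0:ℝ) 1 → u₁' z = u₂' z) (hrow : SjProfileRow c' j u u₁') :
    SjProfileRow c' j u u₂' := by
  intro ε hε
  rw [← sjProfileMain_congr_ae h]
  exact hrow ε hε

/-! ### Polynomial short pieces -/

/-- The real trace `x ↦ p(x)` of a complex polynomial has real derivative `p′(x)`. [folklore] -/
private theorem hasDerivAt_polyEval_ofReal' (p : ℂ[X]) (x : ℝ) :
    HasDerivAt (fun y : ℝ => p.eval (y : ℂ)) ((derivative p).eval (x : ℂ)) x :=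
  (p.hasDerivAt (x : ℂ)).comp_ofReal

/-- **ROW (S) FOR POLYNOMIAL SHORT PIECES:** `PolyShortPiece θ u u′` with `0 < θ < 1` gives `SjProfileRow c′ j u u′` for every
`c′` and `j ∈ {1,2,3}`. [cite: Zhang2022LandauSiegel, §8 Lemmas 8.2–8.4, (8.10)–(8.12), pp.47–48] -/
theorem sjProfileRow_polyShortPiece (c' : ℝ) {θ : ℝ} (hθ0 : 0 < θ) (hθ1 : θ < 1) {u u' : ℝ → ℂ}
    (h : PolyShortPiece θ u u') {j : ℕ} (hj : j ∈ ({1, 2, 3} : Finset ℕ)) : SjProfileRow c' j u u' := by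
  obtain ⟨p, hp, rfl, rfl⟩ := h.exists_poly
  -- smooth derivative data: `v′ = p′·1_{(-∞,θ]}`, `v″ = p″`
  set v' : ℝ → ℂ := fun y => if y ≤ θ then (derivative p).eval (y : ℂ) else 0 with hv'
  set v'' : ℝ → ℂ := fun y => (derivative (derivative p)).eval (y : ℂ) with hv''
  have hcp : Continuous fun y : ℝ => p.eval (y : ℂ) := p.continuous.comp continuous_ofReal
  have hcp' : Continuous fun y : ℝ => (derivative p).eval (y : ℂ) := (derivative p).continuous.comp continuous_ofReal
  have hcp'' : Continuous fun y : ℝ => (derivative (derivative p)).eval (y : ℂ) :=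
    (derivative (derivative p)).continuous.comp continuous_ofReal
  have hu : ContinuousOn (polyPiece θ p) (Icc 0 θ) := (continuous_polyPiece hp).continuousOn
  have hu' : ContinuousOn v' (Icc 0 θ) :=
    hcp'.continuousOn.congr fun y hy => by simp [hv', hy.2]
  have hu'' : ContinuousOn v'' (Icc 0 θ) := hcp''.continuousOn
  have hd : ∀ y : ℝ, y < θ → HasDerivAt (polyPiece θ p) (v' y) y := by
    intro y hy
    have hev : polyPiece θ p =ᶠ[𝓝 y] fun x : ℝ => p.eval (x : ℂ) :=
      eventually_of_mem (Iio_mem_nhds hy) fun x hx => polyPiece_of_lt hx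
    have h1 := (hasDerivAt_polyEval_ofReal' p y).congr_of_eventuallyEq hev
    have e : v' y = (derivative p).eval (y : ℂ) := by simp [hv', hy.le]
    rw [e]; exact h1
  have hd' : ∀ y : ℝ, y < θ → HasDerivAt v' (v'' y) y := by
    intro y hy
    have hev : v' =ᶠ[𝓝 y] fun x : ℝ => (derivative p).eval (x : ℂ) :=
      eventually_of_mem (Iio_mem_nhds hy) fun x hx => by simp [hv', (Set.mem_Iio.mp hx).le]
    exact (hasDerivAt_polyEval_ofReal' (derivative p) y).congr_of_eventuallyEq hev
  have hvan : ∀ y : ℝ, θ ≤ y → polyPiece θ p y = 0 := fun y hy => polyPiece_of_le hy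
  have hvan' : ∀ y : ℝ, θ < y → v' y = 0 := fun y hy => by simp [hv', not_le.mpr hy]
  have hrow := sjProfileRow_C2 c' hθ0 hθ1 hu hu' hu'' hd hd' hvan hvan' hj
  refine sjProfileRow_congr_ae ?_ hrow
  -- `v′ = polyPieceDeriv θ p` away from the single point `θ`
  have hae : ∀ᵐ z ∂(volume : Measure ℝ), z ∉ ({θ} : Set ℝ) :=
    measure_eq_zero_iff_ae_notMem.mp Real.volume_singleton
  filter_upwards [hae] with z hz _
  have hz' : z ≠ θ := hz
  rcases lt_or_gt_of_ne hz' with hlt | hgt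
  · simp [hv', hlt.le, polyPieceDeriv_of_lt hlt]
  · simp [hv', not_le.mpr hgt, polyPieceDeriv_of_le hgt.le]

/-- **Degenerate pieces:** if `u = 0` and `u′ = 0` on `[0,∞)` (e.g. a polynomial piece of length `θ ≤ 0`), then both sides of
row (S) vanish (`𝐚_u = 0`, `𝔪_j(u) = 0`), so `SjProfileRow c′ j u u′` holds (`𝔞 ≥ a₀ > 0` under (A)).
[cite: Zhang2022LandauSiegel, §7 (7.2)] -/
theorem sjProfileRow_of_vanish (c' : ℝ) (j : ℕ) {u u' : ℝ → ℂ} (hu : ∀ y : ℝ, 0 ≤ y → u y = 0)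
    (hu' : ∀ y : ℝ, 0 ≤ y → u' y = 0) : SjProfileRow c' j u u' := by
  intro ε hε
  obtain ⟨a₀, ha₀, hAlow⟩ := frakALowerBound_holds
  refine hAlow.mono ?_
  intro D _ χ _ _ hAD hA
  have hprof : profTable u D χ = fun _ => 0 := by
    funext n
    unfold profTable
    split_ifs
    · rw [hu _ (div_nonneg (Real.log_natCast_nonneg n) ?_), mul_zero]
      rw [bigP, Real.log_exp]
      exact pow_nonneg (Real.log_natCast_nonneg D) 9
    · rfl
  have hS : Sj c' D j (profTable u D χ) (fun n => conj (profTable u D χ n)) = 0 := by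
    rw [hprof]; simp [Sj]
  have hm : sjProfileMain j u u' = 0 := by
    unfold sjProfileMain
    rw [intervalIntegral.integral_congr (g := fun _ => (0:ℂ)) ?_]
    · simp
    · intro z hz
      rw [Set.uIcc_of_le zero_le_one] at hz
      simp [k0jet, hu z hz.1, hu' z hz.1]
  rw [hS, hm]
  have : 0 ≤ ε * frakA χ := mul_nonneg hε.le (ha₀.le.trans (hAD hA))
  simpa using this

/-- **Row (S) for every polynomial short piece of length `θ < 1`** (lengths `θ ≤ 0` are degenerate pieces).
[cite: Zhang2022LandauSiegel, §8 Lemmas 8.2–8.4, (8.10)–(8.12), pp.47–48] -/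
theorem sjProfileRow_polyShortPiece' (c' : ℝ) {θ : ℝ} (hθ1 : θ < 1) {u u' : ℝ → ℂ} (h : PolyShortPiece θ u u')
    {j : ℕ} (hj : j ∈ ({1, 2, 3} : Finset ℕ)) : SjProfileRow c' j u u' := by
  by_cases hθ0 : 0 < θ
  · exact sjProfileRow_polyShortPiece c' hθ0 hθ1 h hj
  · have hθ : θ ≤ 0 := not_lt.mp hθ0
    obtain ⟨p, hp, rfl, rfl⟩ := h.exists_poly
    exact sjProfileRow_of_vanish c' j (fun y hy => polyPiece_of_le (hθ.trans hy))
      (fun y hy => polyPieceDeriv_of_le (hθ.trans hy))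

/-- **THE REPAIRED K0 ASYMPTOTIC FOR POLYNOMIAL SHORT PIECES:** there is `c₀ ≥ 0` such that for every `c′ ≥ c₀`, every
polynomial short piece `u` of length `θ < 1` (`PolyShortPiece θ u u′`) and every `ε > 0`, eventually in `D` under (A):
`|discMean c′ χ (profPoly χ · u (⌊P⌋+1)) − mainTermForm u u′·𝔞χ·𝔓D| ≤ ε𝔞𝔓` — Zhang's side-table dictionary (Prop 7.1 /
(8.23)) for the polynomial pieces of the route's `PolyShortPairs` designs (the rows (S) above fed to g0's reduction
`inClassMean_short_of_sjRows`). [cite: Zhang2022LandauSiegel, §7 Prop 7.1, §8 Lemma 8.1, (8.23)] -/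
theorem inClassMean_polyShortPiece :
    ∃ c₀ : ℝ, 0 ≤ c₀ ∧ ∀ c' : ℝ, c₀ ≤ c' → ∀ (θ : ℝ) (u u' : ℝ → ℂ), θ < 1 → PolyShortPiece θ u u' →
      ∀ ε : ℝ, 0 < ε → ForAllLarge fun D _ χ => AssumptionA D χ →
        |discMean c' χ (fun x t => profPoly χ x u (⌊bigP D⌋₊ + 1) t) - mainTermForm u u' * frakA χ * frakP D|
          ≤ ε * frakA χ * frakP D := by
  obtain ⟨c₀, hc0, h⟩ := inClassMean_short_of_sjRows
  refine ⟨c₀, hc0, fun c' hc' θ u u' hθ1 hP => ?_⟩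
  exact h c' hc' u u' θ hP.inClassPiece hθ1 (fun y hy => hP.shortPiece.vanish y hy)
    (sjProfileRow_polyShortPiece' c' hθ1 hP (by simp)) (sjProfileRow_polyShortPiece' c' hθ1 hP (by simp))
    (sjProfileRow_polyShortPiece' c' hθ1 hP (by simp))

/-! ### The `_poly` glue with its side-table hypothesis discharged -/

/-- **`h0′` of the `_poly` glue holds:** `∃ c₁, ∀ c′ ≥ c₁, KnifeEdge.InClassMeanPoly c′`. [cite: Zhang2022LandauSiegel, §8 (8.23)] -/
theorem inClassMeanPoly_eventually : ∃ c₁ : ℝ, ∀ c' : ℝ, c₁ ≤ c' → KnifeEdge.InClassMeanPoly c' := by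
  obtain ⟨c₀, -, h⟩ := inClassMean_polyShortPiece
  exact ⟨c₀, fun c' hc' θ u u' hθ hP ε hε => h c' hc' θ u u' hθ hP ε hε⟩

/-- **THEOREM 1 FROM THE ψ-GRADED PACKAGE ON A POLYNOMIAL-SHORT CLASS, side table discharged:** if for all large `c′` the
package `GradedClosesPsiOn c′ 𝒞` holds on a class `𝒞` whose pairs consist of polynomial pieces of lengths `< 1`, then
Theorem 1 (`KnifeEdge.theorem1_of_gradedClosesPsiOn_pack_eventually_poly` with `h0′ := inClassMeanPoly_eventually`).
[cite: Zhang2022LandauSiegel, §1 Theorem 1, §2 p. 6, §8 (8.23)] -/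
theorem theorem1_of_gradedClosesPsiOn_polyShort {𝒞 : PairClass}
    (h : ∃ c₂ : ℝ, ∀ c' : ℝ, c₂ ≤ c' → GradedClosesPsiOn c' 𝒞)
    (h𝒞 : ∀ f f' g g', 𝒞 f f' g g' →
      (∃ θ : ℝ, θ < 1 ∧ PolyShortPiece θ f f') ∧ (∃ θ : ℝ, θ < 1 ∧ PolyShortPiece θ g g')) : Theorem1 :=
  theorem1_of_gradedClosesPsiOn_pack_eventually_poly inClassMeanPoly_eventually h h𝒞

/-- … and Theorem 2. [cite: Zhang2022LandauSiegel, §1 Theorem 2] -/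
theorem theorem2_of_gradedClosesPsiOn_polyShort {𝒞 : PairClass}
    (h : ∃ c₂ : ℝ, ∀ c' : ℝ, c₂ ≤ c' → GradedClosesPsiOn c' 𝒞)
    (h𝒞 : ∀ f f' g g', 𝒞 f f' g g' →
      (∃ θ : ℝ, θ < 1 ∧ PolyShortPiece θ f f') ∧ (∃ θ : ℝ, θ < 1 ∧ PolyShortPiece θ g g')) : Theorem2 :=
  Skeleton.theorem2_of_theorem1 (theorem1_of_gradedClosesPsiOn_polyShort h h𝒞)

end Literature.NumberTheory.LFunctions.Zhang2022.DipoleRule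

end
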